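import Literature.Analysis.FluidPDE.ClassicalSuitableRegionEnergy
import Literature.Analysis.FluidPDE.LocalTypeI
import HarnessLib

/-!
# The spatially uniform drift `u = t e`: backward NON-uniqueness from the final-time trace ("scar") on the
# whole slab without decay, and on every parabolic cylinder even with a Type-I bound

Analysis/FluidPDE proofs-layer file (theorems + two data definitions, no new `Prop` facts) over the
accepted `IsSuitableWeakSolutionOn`, `HasWeakSpatialGradientOn`, `parabolicCylinder` (`SuitableWeak.lean`,
`parabolicCylinder_nonempty` from `LocalTypeI.lean`),
`IsClassicalNSSolutionOnRegion` (`ClassicalSolutionRegion.lean`) and the bridge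
`IsClassicalNSSolutionOnRegion.isSuitableWeakSolutionOn_of_subset` (`ClassicalSuitableRegionEnergy.lean`).

Lei–Yang–Yuan 2024 (IMRN; arXiv:2311.02429), Example 1.2: backward uniqueness for Navier–Stokes from
non-trivial final data FAILS outside the mild class — `u = (h(t), 0, 0)`, `p = −h′(t) x₁` solves the system
for every `h`, so two such flows with `h₁(T) = h₂(T)` share their final data. This file makes the example a
theorem in the geometry of the blow-up profile classes (backward slab `(−∞,0) × ℝ³`, final time `0`, the
"scar" = ess-sup smallness of the difference on `(−δ,0) × K` for compact `K ∌ 0`), with `h(t) = t`: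

* `uniformDrift e`, `uniformDriftPressure e` — `u(t,x) = t • e`, `p(t,x) = ⟪−e, x⟫`;
* `uniformDrift_isClassical`, `uniformDrift_isSuitable` — classical, hence suitable weak, solution of
  Navier–Stokes (`ν = 1`, `f = 0`) on the open backward slab; `uniformDrift_isSuitable_cylinder` — on every
  `Q_R(0,0)`;
* `tendsto_eLpNorm_uniformDrift_sub` — two drifts have the SAME SCAR (`‖t e₁ − t e₂‖ ≤ δ‖e₁ − e₂‖`);
* `uniformDrift_typeI_cylinder` — on `Q_R(0,0)` the drift obeys the space–time Type-I bound
  `‖u‖ ≤ 2R³‖e‖/(‖x‖ + √(−t))`;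
* `exists_sameScar_not_aeEq_slab` — **backward non-uniqueness from the scar on the whole slab** (LYY Ex. 1.2):
  two suitable weak solutions on `(−∞,0) × ℝ³` with weak gradients and the same scar which are not a.e. equal;
* `exists_sameScar_typeI_not_aeEq_cylinder` — **the same on every parabolic cylinder `Q_R(0,0)`, with the
  Type-I bound** (Serrin-type pressure-driven ambiguity in bounded domains without lateral data).

Written by the disprover of route item `ScarRigidity` (stmt-NavierStokesRegularity-11717, route RellichScar):
the crux's hypotheses `𝐈 < ∞` / `|u| ≤ C/(|x|+√−t)` on the WHOLE slab are what exclude these witnesses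
(decay at spatial infinity on whole time slices is load-bearing; the statement is not local).

## References

* Z. Lei, Z. Yang, C. Yuan, *Backward uniqueness for 3D Navier–Stokes equations with non-trivial final data
  and applications*, IMRN (2024) = arXiv:2311.02429, Example 1.2. [LeiYangYuan2024]
* G. Koch, N. Nadirashvili, G. Seregin, V. Šverák, Acta Math. 203 (2009), §1 (parasitic solutions). [KNSS2009]
* J. Serrin, *On the interior regularity of weak solutions of the Navier–Stokes equations*, ARMA 9 (1962)
  (the example `u = a(t)∇h`). [Serrin1962]
-/

noncomputable section

open Set Filter Function MeasureTheory Metric TopologicalSpace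
open scoped Topology ENNReal NNReal InnerProductSpace RealInnerProductSpace Laplacian

namespace Literature.Analysis.FluidPDE

/-- Local notation for physical space `ℝ³ = EuclideanSpace ℝ (Fin 3)`. -/
local notation "ℝ³" => EuclideanSpace ℝ (Fin 3)

/-- Local notation for the open backward slab `(-∞, 0) × ℝ³` (time first). -/
local notation "𝕊" => slab (EuclideanSpace ℝ (Fin 3)) (Iio (0 : ℝ)) isOpen_Iio


/-! ## A measure-theoretic criterion -/

/-- A.E.-DISTINCTNESS CRITERION: two functions differing at every point of a non-empty open subset of `S`
are not a.e. equal on `S`. [folklore] -/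
theorem not_aeEq_restrict_of_forall_ne_of_isOpen {f g : ℝ × ℝ³ → ℝ³} {S U : Set (ℝ × ℝ³)} (hU : IsOpen U)
    (hUne : U.Nonempty) (hUS : U ⊆ S) (hne : ∀ z ∈ U, f z ≠ g z) :
    ¬ (f =ᵐ[volume.restrict S] g) := by
  intro h
  have hUpos : 0 < volume.restrict S U := by
    rw [Measure.restrict_apply hU.measurableSet, inter_eq_left.2 hUS]
    exact hU.measure_pos volume hUne
  have hnull : volume.restrict S U = 0 :=
    measure_mono_null (fun z hz => by simpa using hne z hz) (ae_iff.1 h)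
  exact hUpos.ne' hnull


/-! ## The drift on the whole slab (LYY 2024, Example 1.2) -/

/-- The spatially uniform (Galilean) drift `u(t, x) = t • e` (LYY 2024, Example 1.2 with `h(t) = t`).
[cite: LeiYangYuan2024, Example 1.2] -/
def uniformDrift (e : ℝ³) : ℝ → ℝ³ → ℝ³ := fun t _ => t • e

/-- Its pressure `p(t, x) = ⟪-e, x⟫` (so that `∂ₜu = e = -∇p`). [cite: LeiYangYuan2024, Example 1.2] -/
def uniformDriftPressure (e : ℝ³) : ℝ → ℝ³ → ℝ := fun _ x => ⟪-e, x⟫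

/-- `∇ₓ ⟪v, x⟫ = v` (Riesz; private copy of `gradient_inner_left_eq` of `ParasiticSlabFlow.lean`, kept local to
avoid the import). [folklore] -/
private theorem gradient_inner_left' (v x : ℝ³) : gradient (fun y : ℝ³ => ⟪v, y⟫) x = v := by
  refine HasGradientAt.gradient ?_
  rw [hasGradientAt_iff_hasFDerivAt]
  have hd : (InnerProductSpace.toDual ℝ ℝ³ v : ℝ³ →L[ℝ] ℝ) = innerSL ℝ v := by
    ext y
    rfl
  rw [hd]
  exact (innerSL ℝ v).hasFDerivAt

/-- The drift is a classical solution of Navier–Stokes (`ν = 1`, `f = 0`) on the open past slab: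
`∂ₜu = e`, `(u·∇)u = 0`, `Δu = 0`, `∇p = -e`, `div u = 0`. [folklore] -/
theorem uniformDrift_isClassical (e : ℝ³) :
    IsClassicalNSSolutionOnRegion (Iio (0 : ℝ) ×ˢ (univ : Set ℝ³)) 1 0 (uniformDrift e) (uniformDriftPressure e) := by
  rw [isClassicalNSSolutionOnRegion_iff_of_isOpen (isOpen_Iio.prod isOpen_univ)]
  refine ⟨?_, ?_, ?_, ?_⟩
  · exact (contDiff_fst.smul contDiff_const).contDiffOn
  · exact (contDiff_const.inner ℝ contDiff_snd).contDiffOn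
  · intro t x _
    have h1 : deriv (fun s => uniformDrift e s x) t = e := by
      have := ((hasDerivAt_id t).smul_const e).deriv
      simpa [uniformDrift] using this
    have h2 : convect (uniformDrift e t) (uniformDrift e t) x = 0 := by
      show fderiv ℝ (fun _ : ℝ³ => t • e) x (t • e) = 0
      rw [fderiv_fun_const]
      rfl
    have h3 : Δ (uniformDrift e t) x = 0 := by
      show Laplacian.laplacian (fun _ : ℝ³ => t • e) x = 0
      rw [InnerProductSpace.laplacian_const]; rfl
    have h4 : gradient (uniformDriftPressure e t) x = -e := gradient_inner_left' (-e) x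
    rw [h1, h2, h3, h4]
    simp
  · intro t x _
    show LinearMap.trace ℝ ℝ³ ((fderiv ℝ (fun _ : ℝ³ => t • e) x : ℝ³ →L[ℝ] ℝ³) : ℝ³ →ₗ[ℝ] ℝ³) = 0
    rw [fderiv_fun_const]
    simp

/-- Hence the drift is a suitable weak solution on the past slab (tree: classical ⇒ suitable,
`IsClassicalNSSolutionOnRegion.isSuitableWeakSolutionOn_of_subset`). [folklore] -/
theorem uniformDrift_isSuitable (e : ℝ³) : IsSuitableWeakSolutionOn 𝕊 1 0 (uniformDrift e) (uniformDriftPressure e) :=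
  (uniformDrift_isClassical e).isSuitableWeakSolutionOn_of_subset one_pos (Q := slab ℝ³ (Iio 0) isOpen_Iio) (fun _ hz => hz)

/-- Two drifts have the same scar: `‖(t • e₁) - (t • e₂)‖ ≤ δ ‖e₁ - e₂‖` on `(−δ, 0) × K`. [folklore] -/
theorem tendsto_eLpNorm_uniformDrift_sub (e₁ e₂ : ℝ³) : ∀ K : Set ℝ³, IsCompact K → (0 : ℝ³) ∉ K →
    Tendsto (fun δ : ℝ => eLpNorm (uncurry (uniformDrift e₁) - uncurry (uniformDrift e₂)) ⊤
      (volume.restrict (Ioo (-δ) 0 ×ˢ K))) (𝓝[>] 0) (𝓝 0) := by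
  intro K hK _
  have hmeas : ∀ δ : ℝ, MeasurableSet (Ioo (-δ) (0 : ℝ) ×ˢ K) := fun δ =>
    measurableSet_Ioo.prod hK.isClosed.measurableSet
  have hbound : ∀ δ : ℝ, 0 < δ → eLpNorm (uncurry (uniformDrift e₁) - uncurry (uniformDrift e₂)) ⊤
      (volume.restrict (Ioo (-δ) 0 ×ˢ K)) ≤ ENNReal.ofReal (δ * ‖e₁ - e₂‖) := by
    intro δ hδ
    rw [eLpNorm_exponent_top]
    refine eLpNormEssSup_le_of_ae_bound ?_
    filter_upwards [ae_restrict_mem (hmeas δ)] with z hz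
    obtain ⟨⟨hz1, hz2⟩, -⟩ := hz
    have : (uncurry (uniformDrift e₁) - uncurry (uniformDrift e₂)) z = z.1 • (e₁ - e₂) := by
      simp [uniformDrift, uncurry, smul_sub]
    rw [this, norm_smul, Real.norm_eq_abs, abs_of_neg hz2]
    exact mul_le_mul_of_nonneg_right (by linarith) (norm_nonneg _)
  have hup : Tendsto (fun δ : ℝ => ENNReal.ofReal (δ * ‖e₁ - e₂‖)) (𝓝[>] 0) (𝓝 0) := by
    have h0 : Tendsto (fun δ : ℝ => δ * ‖e₁ - e₂‖) (𝓝 0) (𝓝 0) := by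
      simpa using (tendsto_id (x := 𝓝 (0 : ℝ))).mul_const ‖e₁ - e₂‖
    simpa using (ENNReal.tendsto_ofReal h0).mono_left nhdsWithin_le_nhds
  refine tendsto_of_tendsto_of_tendsto_of_le_of_le' tendsto_const_nhds hup
    (Eventually.of_forall fun δ => zero_le) ?_
  filter_upwards [self_mem_nhdsWithin] with δ hδ
  exact hbound δ hδ

/-- The past slab has positive (Lebesgue) measure. [folklore] -/
theorem volume_pastSlab_pos : 0 < volume (Iio (0 : ℝ) ×ˢ (univ : Set ℝ³)) :=
  (isOpen_Iio.prod isOpen_univ).measure_pos volume ⟨((-1 : ℝ), (0 : ℝ³)), by simp⟩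

/-- Two different drifts are NOT a.e. equal on the slab (they differ at every point of it).
[folklore] -/
theorem not_aeEqOnSlab_uniformDrift {e₁ e₂ : ℝ³} (he : e₁ ≠ e₂) :
    ¬ (uncurry (uniformDrift e₁) =ᵐ[volume.restrict (Iio (0 : ℝ) ×ˢ (univ : Set ℝ³))] uncurry (uniformDrift e₂)) := by
  intro h
  have hS : MeasurableSet (Iio (0 : ℝ) ×ˢ (univ : Set ℝ³)) := measurableSet_Iio.prod MeasurableSet.univ
  have h' := (ae_restrict_iff' hS).1 h
  have hzero : volume (Iio (0 : ℝ) ×ˢ (univ : Set ℝ³)) = 0 := by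
    rw [measure_eq_zero_iff_ae_notMem]
    filter_upwards [h'] with z hz hzS
    have hz' := hz hzS
    simp only [uncurry, uniformDrift] at hz'
    have ht : z.1 ≠ 0 := (mem_prod.1 hzS).1.ne
    exact he (smul_right_injective ℝ³ ht hz')
  exact volume_pastSlab_pos.ne' hzero

/-- **Backward non-uniqueness from the scar on the whole slab** (Lei–Yang–Yuan 2024, Example 1.2, with
`h(t) = t`): there are two suitable weak solutions of Navier–Stokes (`ν = 1`, `f = 0`) on `(−∞,0) × ℝ³`, with weak
spatial gradients, whose difference is essentially small near the final slice off the origin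
(`ess sup_{(−δ,0)×K} → 0` for every compact `K ∌ 0` — indeed for every compact `K`), and which are NOT a.e. equal:
`u₁ = 0` and the drift `u₂ = t • e`. [cite: LeiYangYuan2024, Example 1.2] -/
theorem exists_sameScar_not_aeEq_slab :
    ∃ (u₁ u₂ : ℝ → ℝ³ → ℝ³) (p₁ p₂ : ℝ → ℝ³ → ℝ) (G₁ G₂ : ℝ → ℝ³ → ℝ³ →L[ℝ] ℝ³),
      IsSuitableWeakSolutionOn 𝕊 1 0 u₁ p₁ ∧ HasWeakSpatialGradientOn 𝕊 u₁ G₁ ∧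
      IsSuitableWeakSolutionOn 𝕊 1 0 u₂ p₂ ∧ HasWeakSpatialGradientOn 𝕊 u₂ G₂ ∧
      (∀ K : Set ℝ³, IsCompact K → (0 : ℝ³) ∉ K →
        Tendsto (fun δ : ℝ => eLpNorm (uncurry u₁ - uncurry u₂) ⊤
          (volume.restrict (Ioo (-δ) 0 ×ˢ K))) (𝓝[>] 0) (𝓝 0)) ∧
      ¬ (uncurry u₁ =ᵐ[volume.restrict (Iio (0 : ℝ) ×ˢ (univ : Set ℝ³))] uncurry u₂) := by
  obtain ⟨e, he⟩ := exists_ne (0 : ℝ³)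
  obtain ⟨G₁, hG₁, -, -⟩ := (uniformDrift_isSuitable 0).localEnergy
  obtain ⟨G₂, hG₂, -, -⟩ := (uniformDrift_isSuitable e).localEnergy
  exact ⟨_, _, _, _, G₁, G₂, uniformDrift_isSuitable 0, hG₁, uniformDrift_isSuitable e, hG₂,
    tendsto_eLpNorm_uniformDrift_sub 0 e, not_aeEqOnSlab_uniformDrift (Ne.symm he)⟩

/-! ## The drift on a parabolic cylinder, with the Type-I bound -/

/-- `Q_R(0,0)` lies in the open past slab. [folklore] -/
theorem parabolicCylinder_zero_subset_slab (R : ℝ) :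
    parabolicCylinder R (0 : ℝ × ℝ³) ⊆ Iio (0 : ℝ) ×ˢ (univ : Set ℝ³) := by
  intro z hz
  rw [mem_parabolicCylinder] at hz
  exact ⟨by simpa using hz.1.2, mem_univ _⟩

/-- The drift restricted to `Q_R(0,0)` is a suitable weak solution there. [folklore] -/
theorem uniformDrift_isSuitable_cylinder (e : ℝ³) (R : ℝ) :
    IsSuitableWeakSolutionOn (parabolicCylinderOpens R (0 : ℝ × ℝ³)) 1 0 (uniformDrift e) (uniformDriftPressure e) :=
  (uniformDrift_isClassical e).isSuitableWeakSolutionOn_of_subset one_pos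
    (Q := parabolicCylinderOpens R (0 : ℝ × ℝ³)) (parabolicCylinder_zero_subset_slab R)

/-- On `Q_R(0,0)` the drift obeys the Type-I bound with `C = 2R³‖e‖`:
`‖t • e‖ ≤ R²‖e‖ ≤ 2R³‖e‖/(‖x‖ + √−t)` since `‖x‖ + √−t < 2R`. [folklore] -/
theorem uniformDrift_typeI_cylinder (e : ℝ³) {R : ℝ} (hR : 0 < R) :
    ∀ z ∈ parabolicCylinder R (0 : ℝ × ℝ³),
      ‖uniformDrift e z.1 z.2‖ ≤ 2 * R ^ 3 * ‖e‖ / (‖z.2‖ + Real.sqrt (-z.1)) := by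
  intro z hz
  rw [mem_parabolicCylinder] at hz
  obtain ⟨⟨hz1, hz2⟩, hz3⟩ := hz
  simp only [Prod.fst_zero, Prod.snd_zero, zero_sub, dist_zero_right] at hz1 hz2 hz3
  have ht : -z.1 < R ^ 2 := by linarith
  have hsqrt : Real.sqrt (-z.1) < R := by
    calc Real.sqrt (-z.1) < Real.sqrt (R ^ 2) := Real.sqrt_lt_sqrt (by linarith) ht
      _ = R := Real.sqrt_sq hR.le
  have hden : 0 < ‖z.2‖ + Real.sqrt (-z.1) :=
    add_pos_of_nonneg_of_pos (norm_nonneg _) (Real.sqrt_pos.2 (by linarith))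
  have hden2 : ‖z.2‖ + Real.sqrt (-z.1) < 2 * R := by linarith
  rw [le_div_iff₀ hden]
  simp only [uniformDrift, norm_smul, Real.norm_eq_abs, abs_of_neg hz2]
  have h1 : -z.1 * ‖e‖ * (‖z.2‖ + Real.sqrt (-z.1)) ≤ R ^ 2 * ‖e‖ * (2 * R) :=
    mul_le_mul (mul_le_mul_of_nonneg_right ht.le (norm_nonneg e)) hden2.le hden.le (by positivity)
  nlinarith [h1, norm_nonneg e]

/-- **Backward non-uniqueness from the scar on every parabolic cylinder, WITH the Type-I bound**: for every
`R > 0` there are two suitable weak solutions of Navier–Stokes on `Q_R(0,0) = (−R²,0) × B_R(0)`, with weak spatial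
gradients, both obeying `‖u(t,x)‖ ≤ C/(‖x‖ + √(−t))` on `Q_R(0,0)` (`C = 2R³`), with the same scar, which are NOT
a.e. equal on `Q_R(0,0)`: `u₁ = 0` and the drift `u₂ = t • e`, `‖e‖ = 1`. (Serrin-type pressure-driven ambiguity:
backward uniqueness from one time slice is false in bounded domains without lateral data; the whole-slab decay
hypotheses of the Type-I profile classes are what exclude the drift.) [folklore] -/
theorem exists_sameScar_typeI_not_aeEq_cylinder {R : ℝ} (hR : 0 < R) :
    ∃ (C : ℝ) (u₁ u₂ : ℝ → ℝ³ → ℝ³) (p₁ p₂ : ℝ → ℝ³ → ℝ) (G₁ G₂ : ℝ → ℝ³ → ℝ³ →L[ℝ] ℝ³),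
      IsSuitableWeakSolutionOn (parabolicCylinderOpens R (0 : ℝ × ℝ³)) 1 0 u₁ p₁ ∧
      HasWeakSpatialGradientOn (parabolicCylinderOpens R (0 : ℝ × ℝ³)) u₁ G₁ ∧
      (∀ z ∈ parabolicCylinder R (0 : ℝ × ℝ³), ‖u₁ z.1 z.2‖ ≤ C / (‖z.2‖ + Real.sqrt (-z.1))) ∧
      IsSuitableWeakSolutionOn (parabolicCylinderOpens R (0 : ℝ × ℝ³)) 1 0 u₂ p₂ ∧
      HasWeakSpatialGradientOn (parabolicCylinderOpens R (0 : ℝ × ℝ³)) u₂ G₂ ∧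
      (∀ z ∈ parabolicCylinder R (0 : ℝ × ℝ³), ‖u₂ z.1 z.2‖ ≤ C / (‖z.2‖ + Real.sqrt (-z.1))) ∧
      (∀ K : Set ℝ³, IsCompact K → (0 : ℝ³) ∉ K →
        Tendsto (fun δ : ℝ => eLpNorm (uncurry u₁ - uncurry u₂) ⊤
          (volume.restrict (Ioo (-δ) 0 ×ˢ K))) (𝓝[>] 0) (𝓝 0)) ∧
      ¬ (uncurry u₁ =ᵐ[volume.restrict (parabolicCylinder R (0 : ℝ × ℝ³))] uncurry u₂) := by
  obtain ⟨e, he⟩ := exists_norm_eq ℝ³ zero_le_one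
  have he0 : e ≠ 0 := by
    rintro rfl
    simp at he
  obtain ⟨G₁, hG₁, -, -⟩ := (uniformDrift_isSuitable_cylinder 0 R).localEnergy
  obtain ⟨G₂, hG₂, -, -⟩ := (uniformDrift_isSuitable_cylinder e R).localEnergy
  have h0 : ∀ z ∈ parabolicCylinder R (0 : ℝ × ℝ³),
      ‖uniformDrift 0 z.1 z.2‖ ≤ 2 * R ^ 3 * ‖e‖ / (‖z.2‖ + Real.sqrt (-z.1)) := by
    intro z hz
    refine le_trans ?_ (uniformDrift_typeI_cylinder e hR z hz)
    simp [uniformDrift]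
  refine ⟨2 * R ^ 3 * ‖e‖, _, _, _, _, G₁, G₂, uniformDrift_isSuitable_cylinder 0 R, hG₁, h0,
    uniformDrift_isSuitable_cylinder e R, hG₂, uniformDrift_typeI_cylinder e hR,
    tendsto_eLpNorm_uniformDrift_sub 0 e, ?_⟩
  refine not_aeEq_restrict_of_forall_ne_of_isOpen (isOpen_parabolicCylinder R 0) (parabolicCylinder_nonempty hR 0)
    subset_rfl (fun z hz => ?_)
  rw [mem_parabolicCylinder] at hz
  have ht : z.1 ≠ 0 := by
    have := hz.1.2
    simp only [Prod.fst_zero] at this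
    exact this.ne
  simp only [uncurry, uniformDrift, smul_zero, ne_eq]
  intro hz'
  exact he0 ((smul_eq_zero.1 hz'.symm).resolve_left ht)

end Literature.Analysis.FluidPDE

end
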